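import Mathlib
import Summits.Ventures.PercRepro2.SwOutSevDefs

/-!
# The pieces of a mixed arm and the inside connectivity of the re-typed arms (blind cell
PercRepro2, night-4 g22, 2026-08-27; proofs/NIGHT4-G22.md §1)

The pieces of the h-piece `AhOfR ζ r` are its components (`pieceC`): a piece lies in the h-piece
(`pieceC_subset`), is closed under adjacency inside it (`mem_pieceC_of_edge`), two pieces coincide
or are disjoint (`pieceC_eq_of_mem`), and every vertex of the h-piece lies in the piece of a dead
edge (`exists_dead_of_mem_AhOfR`: walk from `p r` through the arm).  Inside connectivity on the
red side of a configuration `η`: a piece of a mixed arm is red-connected to `h` inside itself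
(`piece_conn_red` — the only ways into the piece are `h`, the dead edges and the u-edges, the
last two excluded), and an absorbed arm is red-connected to `h` inside itself
(`absArm_conn_red` — `p r` reaches `h` through its red dead edge and the red h-edge of its end).
-/

namespace Summit.Ventures.PercRepro2

namespace MixedArms

open Hull LocRows BigBlock

variable {V : Type*} {E : Type*} [Fintype E] [DecidableEq E]

open scoped Classical

variable {ends : E → Sym2 V} {ρ : Type*} {h u : V} {p : ρ → V}

section Pieces

variable {η : Config E} {r : ρ}

omit [Fintype E] [DecidableEq E] in
/-- A piece of a vertex of the h-piece lies in the h-piece. -/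
lemma pieceC_subset {y : V} (hy : y ∈ AhOfR ends h u p η r) :
    pieceC ends h u p η r y ⊆ AhOfR ends h u p η r := by
  intro v hv
  refine mem_of_conn_of_closed (ends := ends)
    (ω := fun e => decide (e ∈ within ends (AhOfR ends h u p η r))) ?_ hy hv
  intro a _ b hab
  obtain ⟨_, e, he, hends⟩ := openGraph_adj.1 hab
  simp only [decide_eq_true_eq] at he
  obtain ⟨x', hx', y', hy', h'⟩ := he
  rw [hends, Sym2.eq_iff] at h'
  rcases h' with ⟨_, rfl⟩ | ⟨_, rfl⟩
  · exact hy'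
  · exact hx'

omit [Fintype E] [DecidableEq E] in
/-- Pieces are closed under adjacency inside the h-piece. -/
lemma mem_pieceC_of_edge {y a b : V} {e : E} (ha : a ∈ pieceC ends h u p η r y)
    (haA : a ∈ AhOfR ends h u p η r) (hbA : b ∈ AhOfR ends h u p η r) (hends : ends e = s(a, b)) :
    b ∈ pieceC ends h u p η r y := by
  have he : (fun e => decide (e ∈ within ends (AhOfR ends h u p η r))) e = true := by
    simp only [decide_eq_true_eq]
    exact ⟨a, haA, b, hbA, hends⟩
  exact mem_cluster_of_edge ha he hends

omit [Fintype E] [DecidableEq E] in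
/-- `y` lies in its piece. -/
lemma mem_pieceC_self (y : V) : y ∈ pieceC ends h u p η r y := mem_cluster_self _ _ _

omit [Fintype E] [DecidableEq E] in
/-- The piece of a vertex of the piece of `y` is the piece of `y`. -/
lemma pieceC_eq_of_mem {y z : V} (hz : z ∈ pieceC ends h u p η r y) :
    pieceC ends h u p η r z = pieceC ends h u p η r y := by
  ext v
  constructor
  · exact fun hv => conn_trans hz hv
  · exact fun hv => conn_trans (conn_symm hz) hv

omit [Fintype E] [DecidableEq E] in
/-- The piece of a dead edge is the piece of its end. -/
lemma pieceOfEdgeR_eq {e : E} {y : V} (hey : ends e = s(p r, y)) (hy : y ∈ AhOfR ends h u p η r) :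
    pieceOfEdgeR ends h u p η r e = pieceC ends h u p η r y := by
  ext v
  simp only [pieceOfEdgeR, Set.mem_setOf_eq]
  constructor
  · rintro ⟨y', hey', -, hv⟩
    rw [hey, Sym2.eq_iff] at hey'
    rcases hey' with ⟨-, rfl⟩ | ⟨-, hy'⟩
    · exact hv
    · exfalso
      exact hy.2 (by rw [Set.mem_singleton_iff]; exact hy')
  · exact fun hv => ⟨y, hey, hy, hv⟩

omit [Fintype E] [DecidableEq E] in
/-- Two pieces of one arm coincide or are disjoint. -/
lemma pieceC_eq_or_disjoint {y y' : V} :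
    pieceC ends h u p η r y = pieceC ends h u p η r y' ∨
      ∀ v, v ∈ pieceC ends h u p η r y → v ∉ pieceC ends h u p η r y' := by
  by_cases hd : ∃ v, v ∈ pieceC ends h u p η r y ∧ v ∈ pieceC ends h u p η r y'
  · obtain ⟨v, hv, hv'⟩ := hd
    left
    rw [← pieceC_eq_of_mem hv, pieceC_eq_of_mem hv']
  · right
    intro v hv hv'
    exact hd ⟨v, hv, hv'⟩

omit [Fintype E] [DecidableEq E] in
/-- No edge joins two distinct pieces of one arm. -/
lemma pieceC_no_cross {y y' : V} (hy : y ∈ AhOfR ends h u p η r) (hy' : y' ∈ AhOfR ends h u p η r)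
    (hne : pieceC ends h u p η r y ≠ pieceC ends h u p η r y') {e : E} {a b : V}
    (hab : ends e = s(a, b)) (ha : a ∈ pieceC ends h u p η r y) (hb : b ∈ pieceC ends h u p η r y') :
    False := by
  have hb' : b ∈ pieceC ends h u p η r y :=
    mem_pieceC_of_edge ha (pieceC_subset hy ha) (pieceC_subset hy' hb) hab
  exact hne (by rw [← pieceC_eq_of_mem hb', pieceC_eq_of_mem hb])

omit [Fintype E] [DecidableEq E] in
/-- **Every vertex of the h-piece lies in the piece of a dead edge**: walk from `p r` through the
arm; the last step out of `p r` is a dead edge whose piece is closed under the rest of the walk. -/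
lemma exists_dead_of_mem_AhOfR {x : V} (hx : x ∈ AhOfR ends h u p η r) :
    ∃ e y, ends e = s(p r, y) ∧ y ∈ AhOfR ends h u p η r ∧ x ∈ pieceC ends h u p η r y := by
  let S : Set V := {v | v = p r ∨ (v ∈ AhOfR ends h u p η r ∧
    ∃ e y, ends e = s(p r, y) ∧ y ∈ AhOfR ends h u p η r ∧ v ∈ pieceC ends h u p η r y)}
  have hclosed : ∀ a ∈ S, ∀ b, (openGraph ends (armConfigC ends h u η)).Adj a b → b ∈ S := by
    intro a ha b hab
    obtain ⟨hne, e, he, hends⟩ := openGraph_adj.1 hab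
    have hbA : b ∈ armC ends h u η (p r) := by
      rcases ha with rfl | ⟨ha, -⟩
      · exact mem_cluster_of_edge (mem_armC_self _) he hends
      · exact mem_cluster_of_edge ha.1 he hends
    by_cases hbp : b = p r
    · exact Or.inl hbp
    right
    refine ⟨⟨hbA, hbp⟩, ?_⟩
    rcases ha with rfl | ⟨haA, e', y, hey, hy, hay⟩
    · exact ⟨e, b, hends, ⟨hbA, hbp⟩, mem_pieceC_self b⟩
    · exact ⟨e', y, hey, hy, mem_pieceC_of_edge hay haA ⟨hbA, hbp⟩ hends⟩
  have hxS : x ∈ S := mem_of_conn_of_closed hclosed (Or.inl rfl) hx.1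
  rcases hxS with hxp | ⟨-, e, y, hey, hy, hxy⟩
  · exact absurd hxp hx.2
  · exact ⟨e, y, hey, hy, hxy⟩

end Pieces

section Inside

variable {η : Config E} {r : ρ}

omit [DecidableEq E] in
/-- **Inside connectivity of a piece of a mixed arm on the red side**: when the arm of `p r` lies
on the red side, no u-edge enters it except at `p r`, and the dead edges are blue, every vertex of
a piece is red-connected to `h` inside the piece with `h`. -/
theorem piece_conn_red (hP : armC ends h u η (p r) ∈ armsC ends h u η)
    (hPR : armC ends h u η (p r) ⊆ redExt ends h u η)
    (hno_u : ∀ e x, ends e = s(u, x) → x ∈ armC ends h u η (p r) → x = p r)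
    (hdead : ∀ e x, ends e = s(p r, x) → x ∈ AhOfR ends h u p η r → η e = false)
    {y : V} (hy : y ∈ AhOfR ends h u p η r) :
    ∀ x ∈ pieceC ends h u p η r y,
      x ∈ cluster ends (insideConfig ends (pieceC ends h u p η r y ∪ {h}) η) h := by
  set P := pieceC ends h u p η r y with hPdef
  have hPA : P ⊆ AhOfR ends h u p η r := pieceC_subset hy
  have hPsub := armsC_subset hP
  have hhP : h ∉ P := fun hh => (hPsub h (hPA hh).1).2.1 rfl
  have huP : u ∉ P := fun hu => (hPsub u (hPA hu).1).2.2 rfl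
  have hpP : p r ∉ P := fun hp => (hPA hp).2 rfl
  let S : Set V := {v | v ∉ P ∨ v ∈ cluster ends (insideConfig ends (P ∪ {h}) η) h}
  have hclosed : ∀ a ∈ S, ∀ b, (openGraph ends η).Adj a b → b ∈ S := by
    intro a ha b hab
    obtain ⟨_, e, he, hends⟩ := openGraph_adj.1 hab
    by_cases hbP : b ∈ P
    · right
      by_cases haP : a ∈ P
      · have hin : insideConfig ends (P ∪ {h}) η e = true :=
          insideConfig_eq_true_iff.2 ⟨he, a, Or.inl haP, b, Or.inl hbP, hends⟩
        rcases ha with ha | ha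
        · exact absurd haP ha
        · exact mem_cluster_of_edge ha hin hends
      by_cases hah : a = h
      · rw [hah] at hends
        have hin : insideConfig ends (P ∪ {h}) η e = true :=
          insideConfig_eq_true_iff.2 ⟨he, h, Or.inr rfl, b, Or.inl hbP, hends⟩
        exact mem_cluster_of_edge (mem_cluster_self _ _ _) hin hends
      by_cases hau : a = u
      · exfalso
        rw [hau] at hends
        exact (hPA hbP).2 (hno_u e b hends (hPA hbP).1)
      by_cases hap : a = p r
      · exfalso
        rw [hap] at hends
        have := hdead e b hends (hPA hbP)
        rw [he] at this
        exact Bool.noConfusion this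
      · exfalso
        have haA : a ∈ armC ends h u η (p r) :=
          mem_armsC_of_red_edge hP hPR hends (hPA hbP).1 he hah hau
        have haP' : a ∈ P := by
          rw [hPdef, ← pieceC_eq_of_mem hbP]
          exact mem_pieceC_of_edge (mem_pieceC_self b) (hPA hbP) ⟨haA, hap⟩ (ends_swap hends)
        exact haP haP'
    · exact Or.inl hbP
  intro x hx
  have hxR := hPR (hPA hx).1
  rw [mem_redExt_iff] at hxR
  have hxS : x ∈ S := by
    rcases hxR.1 with hx' | hx'
    · exact mem_of_conn_of_closed hclosed (Or.inl hhP) hx'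
    · exact mem_of_conn_of_closed hclosed (Or.inl huP) hx'
  rcases hxS with h' | h'
  · exact absurd hx h'
  · exact h'

omit [DecidableEq E] in
/-- **Inside connectivity of an absorbed arm on the red side**: when the arm of `p r` lies on the
red side, no u-edge enters it except at `p r`, some dead edge `p r`–`y₀` is red and the h-edge of
`y₀` is red, every vertex of the arm is red-connected to `h` inside the arm with `h`. -/
theorem absArm_conn_red (hP : armC ends h u η (p r) ∈ armsC ends h u η)
    (hPR : armC ends h u η (p r) ⊆ redExt ends h u η)
    (hno_u : ∀ e x, ends e = s(u, x) → x ∈ armC ends h u η (p r) → x = p r)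
    {e₀ e₁ : E} {y₀ : V} (he₀ : ends e₀ = s(p r, y₀)) (hy₀ : y₀ ∈ AhOfR ends h u p η r)
    (hred₀ : η e₀ = true) (he₁ : ends e₁ = s(y₀, h)) (hred₁ : η e₁ = true) :
    ∀ x ∈ armC ends h u η (p r),
      x ∈ cluster ends (insideConfig ends (armC ends h u η (p r) ∪ {h}) η) h := by
  set A := armC ends h u η (p r) with hAdef
  have hAsub := armsC_subset hP
  have hhA : h ∉ A := fun hh => (hAsub h hh).2.1 rfl
  have huA : u ∉ A := fun hu => (hAsub u hu).2.2 rfl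
  have hpA : p r ∈ A := mem_armC_self _
  -- `p r` is inside-connected to `h` through `y₀`
  have hpin : p r ∈ cluster ends (insideConfig ends (A ∪ {h}) η) h := by
    have hin₁ : insideConfig ends (A ∪ {h}) η e₁ = true :=
      insideConfig_eq_true_iff.2 ⟨hred₁, h, Or.inr rfl, y₀, Or.inl hy₀.1, ends_swap he₁⟩
    have hy₀c : y₀ ∈ cluster ends (insideConfig ends (A ∪ {h}) η) h :=
      mem_cluster_of_edge (mem_cluster_self _ _ _) hin₁ (ends_swap he₁)
    have hin₀ : insideConfig ends (A ∪ {h}) η e₀ = true :=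
      insideConfig_eq_true_iff.2 ⟨hred₀, y₀, Or.inl hy₀.1, p r, Or.inl hpA, ends_swap he₀⟩
    exact mem_cluster_of_edge hy₀c hin₀ (ends_swap he₀)
  let S : Set V := {v | v ∉ A ∨ v ∈ cluster ends (insideConfig ends (A ∪ {h}) η) h}
  have hclosed : ∀ a ∈ S, ∀ b, (openGraph ends η).Adj a b → b ∈ S := by
    intro a ha b hab
    obtain ⟨_, e, he, hends⟩ := openGraph_adj.1 hab
    by_cases hbA : b ∈ A
    · right
      by_cases haA : a ∈ A
      · have hin : insideConfig ends (A ∪ {h}) η e = true :=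
          insideConfig_eq_true_iff.2 ⟨he, a, Or.inl haA, b, Or.inl hbA, hends⟩
        rcases ha with ha | ha
        · exact absurd haA ha
        · exact mem_cluster_of_edge ha hin hends
      by_cases hah : a = h
      · rw [hah] at hends
        have hin : insideConfig ends (A ∪ {h}) η e = true :=
          insideConfig_eq_true_iff.2 ⟨he, h, Or.inr rfl, b, Or.inl hbA, hends⟩
        exact mem_cluster_of_edge (mem_cluster_self _ _ _) hin hends
      by_cases hau : a = u
      · rw [hau] at hends
        rw [hno_u e b hends hbA]
        exact hpin
      · exfalso
        exact haA (mem_armsC_of_red_edge hP hPR hends hbA he hah hau)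
    · exact Or.inl hbA
  intro x hx
  have hxR := hPR hx
  rw [mem_redExt_iff] at hxR
  have hxS : x ∈ S := by
    rcases hxR.1 with hx' | hx'
    · exact mem_of_conn_of_closed hclosed (Or.inl hhA) hx'
    · exact mem_of_conn_of_closed hclosed (Or.inl huA) hx'
  rcases hxS with h' | h'
  · exact absurd hx h'
  · exact h'

end Inside

end MixedArms

end Summit.Ventures.PercRepro2
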